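import Summits.QuantumFields.YangMills.Theorems.LangevinControlUVOSLegsAtWeakCouplingCSketchSplit
import HarnessLib

/-!
# Crux `OSLegsAtWeakCouplingC` (stmt-QuantumFields-16207), line `Sketch`: the lead's proof skeleton (v10c, lead c7)

Continuation lead `prover-line-stmt-QuantumFields-16207-c7-0` (2026-08-17).  v10c = v10b (lead c6, registered 3c7bef86) with the
composition read through the LANDED def-free glue `osLegsAtWeakCouplingC_of_subs` (`Theorems/…SketchSplit.lean`, p140922, now served by
the farm) instead of the in-file re-derivation; the three registered stubs are BYTE-IDENTICAL to v10b's (= the three candidate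
sub-crux items of children.json, in route-file vocabulary, each ≤ 3900 characters, re-registered with full signatures by this seat):

* `stub_uvHyperscaling`         : `UVHyperscalingC`          — E0′C, H1 → H2 → H3 ⟹ volume-uniform hyperscaling `(C/R⁴)ⁿ` for the
  centred mixed moments of single-plane plaquette fields on EVERY odd torus (≡ `MomentBounds6`, `uvHyperscalingC_pointwise_iff`);
* `stub_largeTorusNonTriviality` : `LargeTorusNonTrivialityC` — NTC, H1 → H2 → H3 ⟹ k-free lower bounds `ε ≤ Q2(θv,v)`, `ε ≤ |Q3(f,g,h)|`
  for the action density on all LARGE tori `a(β)·L ≥ Λ₅` (⇔ `LowerBounds`; NECESSARY along the witnessing scheme, p138920);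
* `stub_latticeWardGerm`         : `LatticeWardGermC`         — E1C, H1 → H3 → E0′ ⟹ lattice rotation-Ward defect of the centred
  `n`-point distributions (`n ≥ 2`, separated, small diameter) `→ 0` along every scheme in units `a` with `β_k → ∞` (NECESSARY in
  lattice form, p139098; barrier `RegularisationDichotomy`).

`OSLegsAtWeakCouplingC_of` below is LITERALLY `osLegsAtWeakCouplingC_of_subs stub_uvHyperscaling stub_largeTorusNonTriviality
stub_latticeWardGerm` — the crux BY NAME, sorry-free modulo the three stubs — i.e. the kernel-checked content of the planner command
  `ledger route edit route-QuantumFields-LangevinControlUV --split OSLegsAtWeakCouplingC --into children.json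
     --glue-by Summit.QuantumFields.YangMills.Cruxes.OSLegsAtWeakCouplingC.Sketch.osLegsAtWeakCouplingC_of_subs`
(re-verified by this seat against the tree of 2026-08-17T04:40Z: the three children elaborate with exactly the route file's
imports/namespace/opens, `work/SplitSigsC7.lean` rc 0; against route-style defs the glue has type
`UVHyperscalingC → LargeTorusNonTrivialityC → LatticeWardGermC → OSLegsAtWeakCouplingC` as a term and by `exact`,
`work/SplitGlueCheckC7.lean` rc 0).

Everything provable inside the line is landed (stubs `stub_density` p123998, `stub_cluster` p125365, `stub_locality` p131928 + 10
helper files, `stub_rope` p133794, `stub_hypercubic` p115564, `stubPin_of_continuous`, `stub_collar6`, `fbl_of_fbl6`, `stub_lower`,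
`stub_growth`, `stub_gap`; compositions …SketchConditional p132819 … …SketchPencil2 p137364, …SketchRetype p138533, necessity
…SketchNecessityNT p138920 / …SketchNecessityE1 p139098, split …SketchSplit p140922).  The three stubs are engine-grade (UV stability
with composite insertions on all volumes; femto → large-torus transfer of non-triviality; dynamical rotation restoration): none is
derivable from H1–H3 inside any line (the scheme's tori have `a_k L_k → ∞`, where H1/H2 are silent; H3 is an upper bound with
β-uniform, non-hyperscaling constants), none is formally refutable (Disproof §1 wall: every `¬` needs an H1 ∧ H3 witness = the lattice
gap at all weak couplings) — they are NOT staffed from here: PROMOTE (standing hand-back since lead c3).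
Card `Cruxes/OSLegsAtWeakCouplingC/Ideas/axis-cross-analyticity-e1-locality.md`; status `Lines/Sketch.md`; hand-back
`Cruxes/OSLegsAtWeakCouplingC/NOTES.md`.
-/

set_option autoImplicit false

open scoped SchwartzMap BigOperators
open MeasureTheory Filter Topology
open Literature.MathematicalPhysics.QuantumFieldTheory Literature.MathematicalPhysics.QuantumLattice
open Literature.MathematicalPhysics.AQFT Literature.Probability.LatticeModels
open Summit.QuantumFields.YangMills.Theses.LangevinControlUV (OSLegsAtWeakCouplingC)

namespace Summit.QuantumFields.YangMills.Cruxes.OSLegsAtWeakCouplingC.Sketch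

/-! ## The registered stubs (the only sorries) — verbatim the candidate items of children.json -/

/-- **stub_uvHyperscaling** [IMPORT E0′C = candidate item `UVHyperscalingC`; engine-grade, not staffed here]:
for every compact simple `G`, `r`, continuous unit map `a` carrying H1 (femto two-point package), H2 (skewness
witness), H3 (clustering in units `a`): volume-uniform hyperscaling `(C/R⁴)ⁿ` for the centred mixed moments of `n`
single-plane plaquette fields at pairwise torus sup-distance `≥ 2R+4` (`1 ≤ R`, `R a(β) ≤ ℓ₄`, `4R+8 ≤ L`) on EVERY
odd torus, `β ≥ β₄` (≡ `MomentBounds6 G r a`, `uvHyperscalingC_pointwise_iff`). -/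
theorem stub_uvHyperscaling :
    open Literature.MathematicalPhysics.QuantumLattice Literature.MathematicalPhysics.AQFT Literature.MathematicalPhysics.QuantumFieldTheory Literature.Probability.LatticeModels in ∀ (G : Type) [Group G] [TopologicalSpace G] [IsTopologicalGroup G] [CompactSpace G], IsCompactSimpleLieGroup G → letI : MeasurableSpace G := borel G; haveI : BorelSpace G := ⟨rfl⟩; ∀ (r : LatticeRep G), ∀ (a : ℝ → ℝ), Continuous a → (∃ (Γ : ℝ → ℝ) (β₀ ℓ₀ c C : ℝ), 0 < ℓ₀ ∧ 0 < c ∧ (∀ β, 0 < a β) ∧ Filter.Tendsto a Filter.atTop (nhds 0) ∧ (∀ s : ℝ, 0 < s → s ≤ ℓ₀ → 0 < Γ s ∧ Γ s ≤ 1) ∧ ∀ (L : ℕ) [NeZero L] (β : ℝ), β₀ ≤ β → (L : ℝ) * a β ≤ ℓ₀ → let P : (Fin 4 → ZMod L) → Fin 4 → Fin 4 → GaugeConfig 4 L G → ℝ := fun x i j U => (r.N : ℝ) - (r.ρ (plaquetteHolonomy U x i j)).trace.re; let E : (GaugeConfig 4 L G → ℝ) → ℝ := fun F => wilsonExpectation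 (d := 4) (L := L) r.ρ β F; let cov : (GaugeConfig 4 L G → ℝ) → (GaugeConfig 4 L G → ℝ) → ℝ := fun F F' => E (fun U => F U * F' U) - E F * E F'; let dist : (Fin 4 → ZMod L) → (Fin 4 → ZMod L) → ℝ := fun x y => Real.sqrt (∑ k : Fin 4, (((x k - y k).valMinAbs : ℤ) : ℝ) ^ 2); (∀ n : ℕ, 1 ≤ n → 8 * n ≤ L → c * Γ ((n : ℝ) * a β) ≤ (n : ℝ) ^ 8 * cov (P 0 0 1) (P (Pi.single (2 : Fin 4) ((n : ℕ) : ZMod L)) 0 1) ∧ (n : ℝ) ^ 8 * cov (P 0 0 1) (P (Pi.single (2 : Fin 4) ((n : ℕ) : ZMod L)) 0 1) ≤ C * Γ ((n : ℝ) * a β)) ∧ (∀ (x y : Fin 4 → ZMod L) (i j i' j' : Fin 4), x ≠ y → i ≠ j → i' ≠ j' → |cov (P x i j) (P y i' j')| * dist x y ^ 8 ≤ C * Γ (dist x y * a β))) → (∃ (Γ₃ : ℝ → ℝ) (β₁ ℓ₁ c₃ : ℝ), 0 < ℓ₁ ∧ 0 < c₃ ∧ (∀ s : ℝ, 0 < s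 → s ≤ ℓ₁ → 0 < Γ₃ s) ∧ ∀ (L : ℕ) [NeZero L] (β : ℝ), β₁ ≤ β → (L : ℝ) * a β ≤ ℓ₁ → let P : (Fin 4 → ZMod L) → Fin 4 → Fin 4 → GaugeConfig 4 L G → ℝ := fun x i j U => (r.N : ℝ) - (r.ρ (plaquetteHolonomy U x i j)).trace.re; let E : (GaugeConfig 4 L G → ℝ) → ℝ := fun F => wilsonExpectation (d := 4) (L := L) r.ρ β F; let cov : (GaugeConfig 4 L G → ℝ) → (GaugeConfig 4 L G → ℝ) → ℝ := fun F F' => E (fun U => F U * F' U) - E F * E F'; ∀ n : ℕ, 1 ≤ n → 8 * n ≤ L → c₃ * Γ₃ ((n : ℝ) * a β) ≤ (n : ℝ) ^ 12 * |E (fun U => P 0 0 1 U * P (Pi.single (2 : Fin 4) ((n : ℕ) : ZMod L)) 0 1 U * P (Pi.single (3 : Fin 4) ((n : ℕ) : ZMod L)) 0 1 U) - E (P 0 0 1) * cov (P (Pi.single (2 : Fin 4) ((n : ℕ) : ZMod L)) 0 1) (P (Pi.single (3 : Fin 4) ((n : ℕ) : ZMod L)) 0 1) - E (P (Pi.single (2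 : Fin 4) ((n : ℕ) : ZMod L)) 0 1) * cov (P 0 0 1) (P (Pi.single (3 : Fin 4) ((n : ℕ) : ZMod L)) 0 1) - E (P (Pi.single (3 : Fin 4) ((n : ℕ) : ZMod L)) 0 1) * cov (P 0 0 1) (P (Pi.single (2 : Fin 4) ((n : ℕ) : ZMod L)) 0 1) - E (P 0 0 1) * E (P (Pi.single (2 : Fin 4) ((n : ℕ) : ZMod L)) 0 1) * E (P (Pi.single (3 : Fin 4) ((n : ℕ) : ZMod L)) 0 1)|) → (∃ (c₁ β₂ : ℝ) (S₁ : ℝ → ℕ), 0 < c₁ ∧ ∀ A B : YMSpecies G, ∃ C : ℝ, ∀ β : ℝ, β₂ ≤ β → ∀ S n : ℕ, S₁ β ≤ S → n ≤ S → |latticeConnectedCorr r.ρ β (2 * S + 1) A.F B.F n| ≤ C * Real.exp (-(c₁ * a β * n))) → ∃ (C β₄ ℓ₄ : ℝ), 0 < ℓ₄ ∧ 0 ≤ C ∧ ∀ β : ℝ, β₄ ≤ β → ∀ (L n : ℕ) (q : Fin n → Fin 4 × Fin 4) (x : Fin n → (Fin 4 → ℤ)) (R : ℕ), (∀ i, (q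 i).1 < (q i).2) → 1 ≤ R → (R : ℝ) * a β ≤ ℓ₄ → 4 * R + 8 ≤ L → (∀ i j : Fin n, i ≠ j → ∃ k : Fin 4, (2 * (R : ℤ) + 4) ≤ |((((x i k - x j k : ℤ) : ZMod (2 * L + 1))).valMinAbs : ℤ)|) → let E : (LGConfig 4 G → ℝ) → ℝ := fun F => ∫ U, F (torusLift (2 * L + 1) U) ∂(wilsonMeasure (d := 4) (L := 2 * L + 1) r.ρ β); let Pl : Fin 4 × Fin 4 → (Fin 4 → ℤ) → LGConfig 4 G → ℝ := fun p y U => plaquetteObs r.ρ 0 p.1 p.2 (configShift (-y) U); |E (fun U => ∏ i, (Pl (q i) (x i) U - E (Pl (q i) (x i))))| ≤ (C / (R : ℝ) ^ 4) ^ n := by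
  sorry

/-- **stub_largeTorusNonTriviality** [IMPORT NTC = candidate item `LargeTorusNonTrivialityC`; engine-grade, NECESSARY
(p138920), not staffed here]: for every `G`, `r`, continuous `a` carrying H1–H3: ONE quantifier block of real test
functions `v` (positive-time support), `f, g, h` (pairwise disjoint supports), `ε > 0`, `β₅`, `Λ₅` with, on every
torus `a(β)·L ≥ Λ₅` at every `β ≥ β₅`, `ε ≤` the bare smeared truncated two-point function `Q2(θv, v)` AND `ε ≤ |Q3(f,
g, h)|` for the action density (⇔ `LowerBounds G r a`, `largeTorusNonTrivialityC_pointwise_iff`). -/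
theorem stub_largeTorusNonTriviality :
    open Literature.MathematicalPhysics.QuantumLattice Literature.MathematicalPhysics.AQFT Literature.MathematicalPhysics.QuantumFieldTheory Literature.Probability.LatticeModels in ∀ (G : Type) [Group G] [TopologicalSpace G] [IsTopologicalGroup G] [CompactSpace G], IsCompactSimpleLieGroup G → letI : MeasurableSpace G := borel G; haveI : BorelSpace G := ⟨rfl⟩; ∀ (r : LatticeRep G), ∀ (a : ℝ → ℝ), Continuous a → (∃ (Γ : ℝ → ℝ) (β₀ ℓ₀ c C : ℝ), 0 < ℓ₀ ∧ 0 < c ∧ (∀ β, 0 < a β) ∧ Filter.Tendsto a Filter.atTop (nhds 0) ∧ (∀ s : ℝ, 0 < s → s ≤ ℓ₀ → 0 < Γ s ∧ Γ s ≤ 1) ∧ ∀ (L : ℕ) [NeZero L] (β : ℝ), β₀ ≤ β → (L : ℝ) * a β ≤ ℓ₀ → let P : (Fin 4 → ZMod L) → Fin 4 → Fin 4 → GaugeConfig 4 L G → ℝ := fun x i j U => (r.N : ℝ) - (r.ρ (plaquetteHolonomy U x i j)).trace.re; let E : (GaugeConfig 4 L G → ℝ) → ℝ := fun F => wilsonExpectation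 (d := 4) (L := L) r.ρ β F; let cov : (GaugeConfig 4 L G → ℝ) → (GaugeConfig 4 L G → ℝ) → ℝ := fun F F' => E (fun U => F U * F' U) - E F * E F'; let dist : (Fin 4 → ZMod L) → (Fin 4 → ZMod L) → ℝ := fun x y => Real.sqrt (∑ k : Fin 4, (((x k - y k).valMinAbs : ℤ) : ℝ) ^ 2); (∀ n : ℕ, 1 ≤ n → 8 * n ≤ L → c * Γ ((n : ℝ) * a β) ≤ (n : ℝ) ^ 8 * cov (P 0 0 1) (P (Pi.single (2 : Fin 4) ((n : ℕ) : ZMod L)) 0 1) ∧ (n : ℝ) ^ 8 * cov (P 0 0 1) (P (Pi.single (2 : Fin 4) ((n : ℕ) : ZMod L)) 0 1) ≤ C * Γ ((n : ℝ) * a β)) ∧ (∀ (x y : Fin 4 → ZMod L) (i j i' j' : Fin 4), x ≠ y → i ≠ j → i' ≠ j' → |cov (P x i j) (P y i' j')| * dist x y ^ 8 ≤ C * Γ (dist x y * a β))) → (∃ (Γ₃ : ℝ → ℝ) (β₁ ℓ₁ c₃ : ℝ), 0 < ℓ₁ ∧ 0 < c₃ ∧ (∀ s : ℝ, 0 < s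 → s ≤ ℓ₁ → 0 < Γ₃ s) ∧ ∀ (L : ℕ) [NeZero L] (β : ℝ), β₁ ≤ β → (L : ℝ) * a β ≤ ℓ₁ → let P : (Fin 4 → ZMod L) → Fin 4 → Fin 4 → GaugeConfig 4 L G → ℝ := fun x i j U => (r.N : ℝ) - (r.ρ (plaquetteHolonomy U x i j)).trace.re; let E : (GaugeConfig 4 L G → ℝ) → ℝ := fun F => wilsonExpectation (d := 4) (L := L) r.ρ β F; let cov : (GaugeConfig 4 L G → ℝ) → (GaugeConfig 4 L G → ℝ) → ℝ := fun F F' => E (fun U => F U * F' U) - E F * E F'; ∀ n : ℕ, 1 ≤ n → 8 * n ≤ L → c₃ * Γ₃ ((n : ℝ) * a β) ≤ (n : ℝ) ^ 12 * |E (fun U => P 0 0 1 U * P (Pi.single (2 : Fin 4) ((n : ℕ) : ZMod L)) 0 1 U * P (Pi.single (3 : Fin 4) ((n : ℕ) : ZMod L)) 0 1 U) - E (P 0 0 1) * cov (P (Pi.single (2 : Fin 4) ((n : ℕ) : ZMod L)) 0 1) (P (Pi.single (3 : Fin 4) ((n : ℕ) : ZMod L)) 0 1) - E (P (Pi.single (2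 : Fin 4) ((n : ℕ) : ZMod L)) 0 1) * cov (P 0 0 1) (P (Pi.single (3 : Fin 4) ((n : ℕ) : ZMod L)) 0 1) - E (P (Pi.single (3 : Fin 4) ((n : ℕ) : ZMod L)) 0 1) * cov (P 0 0 1) (P (Pi.single (2 : Fin 4) ((n : ℕ) : ZMod L)) 0 1) - E (P 0 0 1) * E (P (Pi.single (2 : Fin 4) ((n : ℕ) : ZMod L)) 0 1) * E (P (Pi.single (3 : Fin 4) ((n : ℕ) : ZMod L)) 0 1)|) → (∃ (c₁ β₂ : ℝ) (S₁ : ℝ → ℕ), 0 < c₁ ∧ ∀ A B : YMSpecies G, ∃ C : ℝ, ∀ β : ℝ, β₂ ≤ β → ∀ S n : ℕ, S₁ β ≤ S → n ≤ S → |latticeConnectedCorr r.ρ β (2 * S + 1) A.F B.F n| ≤ C * Real.exp (-(c₁ * a β * n))) → ∃ (v f g h : SchwartzMap (EuclideanSpace ℝ (Fin 4)) ℝ) (ε β₅ Λ₅ : ℝ), tsupport v ⊆ {y : EuclideanSpace ℝ (Fin 4) | 0 < y 0} ∧ Disjoint (tsupport f) (tsupport g) ∧ Disjoint (tsupport g)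 (tsupport h) ∧ Disjoint (tsupport f) (tsupport h) ∧ 0 < ε ∧ ∀ β : ℝ, β₅ ≤ β → ∀ L : ℕ, Λ₅ ≤ a β * L → let E : (LGConfig 4 G → ℝ) → ℝ := fun F => ∫ U, F (torusLift (2 * L + 1) U) ∂(wilsonMeasure (d := 4) (L := 2 * L + 1) r.ρ β); let D : (Fin 4 → ℤ) → LGConfig 4 G → ℝ := fun x U => r.curvature.F (configShift (-x) U); (ε ≤ ∑ x ∈ box 4 L, ∑ y ∈ box 4 L, thetaTest 4 v (a β • siteToE x) * v (a β • siteToE y) * (E (fun U => D x U * D y U) - E (D x) * E (D y))) ∧ (ε ≤ |∑ x ∈ box 4 L, ∑ y ∈ box 4 L, ∑ z ∈ box 4 L, f (a β • siteToE x) * g (a β • siteToE y) * h (a β • siteToE z) * (E (fun U => D x U * D y U * D z U) - E (D x) * E (fun U => D y U * D z U) - E (D y) * E (fun U => D x U * D z U) - E (D z) * E (fun U => D x U * D y U) + 2 * (E (D x) * E (D y) * E (D z)))|) := by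
  sorry

/-- **stub_latticeWardGerm** [IMPORT E1C = candidate item `LatticeWardGermC`; engine-grade, NECESSARY in lattice
form (p139098), barrier `RegularisationDichotomy`, not staffed here]: for every `G`, `r`, continuous `a` carrying H1
and H3, and given E0′ at `(G, r, a)`: along every scheme in units `a` with `β_k → ∞` and the bundle ranges there is
`r₀ > 0` such that for `n ≥ 2` the centred lattice `n`-point distributions of the action density annihilate, as
`k → ∞`, the `(x₀,x₁)`-rotation-generator derivative `D` of every compactly supported, separated, off-diagonal test
function `F` of diameter `< r₀` (H2 and NT are not inputs of a Ward identity and are not assumed). -/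
theorem stub_latticeWardGerm :
    open Literature.MathematicalPhysics.QuantumLattice Literature.MathematicalPhysics.AQFT Literature.MathematicalPhysics.QuantumFieldTheory Literature.Probability.LatticeModels in ∀ (G : Type) [Group G] [TopologicalSpace G] [IsTopologicalGroup G] [CompactSpace G], IsCompactSimpleLieGroup G → letI : MeasurableSpace G := borel G; haveI : BorelSpace G := ⟨rfl⟩; ∀ (r : LatticeRep G), ∀ (a : ℝ → ℝ), Continuous a → (∃ (Γ : ℝ → ℝ) (β₀ ℓ₀ c C : ℝ), 0 < ℓ₀ ∧ 0 < c ∧ (∀ β, 0 < a β) ∧ Filter.Tendsto a Filter.atTop (nhds 0) ∧ (∀ s : ℝ, 0 < s → s ≤ ℓ₀ → 0 < Γ s ∧ Γ s ≤ 1) ∧ ∀ (L : ℕ) [NeZero L] (β : ℝ), β₀ ≤ β → (L : ℝ) * a β ≤ ℓ₀ → let P : (Fin 4 → ZMod L) → Fin 4 → Fin 4 → GaugeConfig 4 L G → ℝ := fun x i j U => (r.N : ℝ) - (r.ρ (plaquetteHolonomy U x i j)).trace.re; let E : (GaugeConfig 4 L G → ℝ) → ℝ := fun F => wilsonExpectation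 (d := 4) (L := L) r.ρ β F; let cov : (GaugeConfig 4 L G → ℝ) → (GaugeConfig 4 L G → ℝ) → ℝ := fun F F' => E (fun U => F U * F' U) - E F * E F'; let dist : (Fin 4 → ZMod L) → (Fin 4 → ZMod L) → ℝ := fun x y => Real.sqrt (∑ k : Fin 4, (((x k - y k).valMinAbs : ℤ) : ℝ) ^ 2); (∀ n : ℕ, 1 ≤ n → 8 * n ≤ L → c * Γ ((n : ℝ) * a β) ≤ (n : ℝ) ^ 8 * cov (P 0 0 1) (P (Pi.single (2 : Fin 4) ((n : ℕ) : ZMod L)) 0 1) ∧ (n : ℝ) ^ 8 * cov (P 0 0 1) (P (Pi.single (2 : Fin 4) ((n : ℕ) : ZMod L)) 0 1) ≤ C * Γ ((n : ℝ) * a β)) ∧ (∀ (x y : Fin 4 → ZMod L) (i j i' j' : Fin 4), x ≠ y → i ≠ j → i' ≠ j' → |cov (P x i j) (P y i' j')| * dist x y ^ 8 ≤ C * Γ (dist x y * a β))) → (∃ (c₁ β₂ : ℝ) (S₁ : ℝ → ℕ), 0 < c₁ ∧ ∀ A B : YMSpecies G, ∃ C : ℝ, ∀ β : ℝ, β₂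 ≤ β → ∀ S n : ℕ, S₁ β ≤ S → n ≤ S → |latticeConnectedCorr r.ρ β (2 * S + 1) A.F B.F n| ≤ C * Real.exp (-(c₁ * a β * n))) → (∃ (C β₄ ℓ₄ : ℝ), 0 < ℓ₄ ∧ 0 ≤ C ∧ ∀ β : ℝ, β₄ ≤ β → ∀ (L n : ℕ) (q : Fin n → Fin 4 × Fin 4) (x : Fin n → (Fin 4 → ℤ)) (R : ℕ), (∀ i, (q i).1 < (q i).2) → 1 ≤ R → (R : ℝ) * a β ≤ ℓ₄ → 4 * R + 8 ≤ L → (∀ i j : Fin n, i ≠ j → ∃ k : Fin 4, (2 * (R : ℤ) + 4) ≤ |((((x i k - x j k : ℤ) : ZMod (2 * L + 1))).valMinAbs : ℤ)|) → let E : (LGConfig 4 G → ℝ) → ℝ := fun F => ∫ U, F (torusLift (2 * L + 1) U) ∂(wilsonMeasure (d := 4) (L := 2 * L + 1) r.ρ β); let Pl : Fin 4 × Fin 4 → (Fin 4 → ℤ) → LGConfig 4 G → ℝ := fun p y U => plaquetteObs r.ρ 0 p.1 p.2 (configShift (-y) U); |E (fun U => ∏ i, (Pl (q i) (x i) U - E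 (Pl (q i) (x i))))| ≤ (C / (R : ℝ) ^ 4) ^ n) → ∀ (sch : SpeciesScheme (YMSpecies G)), (∀ k, sch.a k = a (sch.β k)) → Filter.Tendsto sch.β Filter.atTop Filter.atTop → (∀ k, 0 ≤ sch.β k ∧ sch.a k ≤ 1 / 24 ∧ 14 ≤ sch.L k ∧ (sch.a k)⁻¹ * (sch.a k)⁻¹ ≤ sch.L k) → ∃ r₀ : ℝ, 0 < r₀ ∧ ∀ (n : ℕ), 2 ≤ n → ∀ (F D : SchwartzMap (Fin n → EuclideanSpace ℝ (Fin 4)) ℂ), IsOffDiagonal F → HasCompactSupport (F : (Fin n → EuclideanSpace ℝ (Fin 4)) → ℂ) → (∃ δ : ℝ, 0 < δ ∧ tsupport (F : (Fin n → EuclideanSpace ℝ (Fin 4)) → ℂ) ⊆ {x | ∀ i j, i ≠ j → δ ≤ dist (x i) (x j)}) → tsupport (F : (Fin n → EuclideanSpace ℝ (Fin 4)) → ℂ) ⊆ {x | ∀ i j, dist (x i) (x j) < r₀} → (∀ x, D x = fderiv ℝ (F : (Fin n → EuclideanSpace ℝ (Fin 4)) → ℂ) x (fun k => (x k 0) • (EuclideanSpace.single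 1 1 : EuclideanSpace ℝ (Fin 4)) - (x k 1) • (EuclideanSpace.single 0 1 : EuclideanSpace ℝ (Fin 4)))) → Filter.Tendsto (fun k : ℕ => ∑ x ∈ Fintype.piFinset (fun _ : Fin n => box 4 (sch.L k)), (((∫ U, ∏ i, (r.curvature.F (configShift (-(x i)) (torusLift (2 * sch.L k + 1) U)) - ∫ V, r.curvature.F (torusLift (2 * sch.L k + 1) V) ∂(wilsonMeasure (d := 4) (L := 2 * sch.L k + 1) r.ρ (sch.β k))) ∂(wilsonMeasure (d := 4) (L := 2 * sch.L k + 1) r.ρ (sch.β k)) : ℝ) : ℂ) * D (fun i => sch.a k • siteToE (x i)))) Filter.atTop (nhds 0) := by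
  sorry

/-! ## The composition (landed glue, p140922) -/

/-- **The crux from the line's stubs.**  `OSLegsAtWeakCouplingC` BY NAME, sorry-free modulo the three registered stubs above, through
the landed route-vocabulary glue `osLegsAtWeakCouplingC_of_subs : E0′C → NTC → E1C → OSLegsAtWeakCouplingC` (…SketchSplit, p140922). -/
theorem OSLegsAtWeakCouplingC_of : OSLegsAtWeakCouplingC :=
  osLegsAtWeakCouplingC_of_subs stub_uvHyperscaling stub_largeTorusNonTriviality stub_latticeWardGerm

end Summit.QuantumFields.YangMills.Cruxes.OSLegsAtWeakCouplingC.Sketch
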